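import Summits.BirchSwinnertonDyer.BirchSwinnertonDyer.Theses.PrintX9
import Summits.BirchSwinnertonDyer.Rank1Residual.X10.AnalyticMuZeroThreeRhoBarInvariance
import Literature.NumberTheory.EllipticCurves.SkinnerUrban2014.PAdicUnitPeriodRatioProofs
import HarnessLib

/-!
# Route PrintX9, crux `AnalyticMuZeroX9` (stmt-BirchSwinnertonDyer-19630): the congruence road,
# class-wide, in the route's currency — the crux is EQUIVALENT to «every X9 pair has a `μ`-certified
# good-ordinary `p`-congruent partner», modulo three cite-only heads of the route's cone

Cell `bsd-print-x9` (D-0131 (2) print tier), seat p2 («`μ = 0` by congruence transport (Greenberg–Vatsal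
2000 (1.4) / Emerton–Pollack–Weston 2006 Thm. 1) + analytic `μ = 0` certificate»), gen 2. HONEST FRAMING:
theorems only (no definition, no new named fact); nothing is booked; a CONDITIONAL helper of crux 19630
(`--supports`), not a closer. Route-currency form of the K6 record
`Theorems/SmallImageMuTransferAnalyticMuZeroX9CertifiedPartner` (p533399, stated there for
`Theses.SmallImageMuTransfer.AnalyticMuZeroX9`), with two improvements: (i) the conclusion is
`Theses.PrintX9.AnalyticMuZeroX9` BY NAME (both route decls unfold to the K6 node
`Rank1Residual.AnalyticMuZeroOnClassX9`; this file does not import the K6 route module), and (ii) the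
period unit `Ω_E = u·Ω⁺_f`, `‖u‖_p = 1` (A25) is no longer a binder: it is Mazur 1978 Cor. 4.1 over the
tree (`SkinnerUrban2014.realPeriodRat_eq_unit_mul_plusPeriod_of_mazur`), i.e. the route's aside 19383
family head `mazur_not_dvd_maninConstant_of_odd`; the EPW input is the odd-prime transcription
(`EmertonPollackWeston2006.thm1_muAn_transfer_of_torsionIso_odd`, x10 GEN 37, p442926), so ONE kernel
lemma (`X10.certificate_of_torsionIso_of_ne_two'`) serves both leaves X9 (`p ∈ {5, 7}`) and X10b (`p = 3`).

## What is proved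

A **certified partner** of an X9 pair `(W, p)` (`Rank1Residual.ClassX9 W p`: non-CM, `p ≥ 5` good
ordinary, `E[p]` irreducible, `ρ̄_{E,p}` not onto) is a globally minimal elliptic `W'/ℚ`, good ordinary at
`p`, with a `Γ_ℚ`-equivariant `W'[p] ≃ W[p]` and a newform `f'` of `W'` (any level) ONE of whose
`L_p(f', α_{W'})`-coefficients is a `p`-adic unit (`W' = W` allowed; `W'[p]` irreducible automatically).

* `printX9_analyticMuZeroX9_of_forall_exists_certifiedPartner` (`hEPW`, `hM`, `hlev`): certified
  partners for all X9 pairs ⟹ `Theses.PrintX9.AnalyticMuZeroX9`.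
* `printX9_forall_exists_certifiedPartner_of_analyticMuZeroX9` (`hmodP`): the converse (the pair itself).
* `printX9_analyticMuZeroX9_iff_forall_exists_certifiedPartner`: **the congruence road, class-wide, is
  EXACTLY crux 19630** — one certificate per mod-`p` representation of the class, transported along
  `H(ρ̄)`; the class has infinitely many `ρ̄` (genus-0 families 5Ns/5S4/7Ns), so the road re-indexes
  Greenberg's analytic `μ = 0` and cannot weaken it; the residual crux of the road is 19630 itself, in
  the shape «a `ρ̄` of the class with NO certifiable good-ordinary partner».
* `printX9_analyticMuZeroX9_iff_forall_exists_certifiedPartner_of_items`: the same with the facts held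
  as the route's asides `ModularParametrizationSupply` (19266) and the Mazur head (19383's constant).

What this is NOT: not a proof of any `μ = 0`; beyond-print theorem: no (bookkeeping over EPW). Evidence
of record for the crux (certificate VALUES, two engines): the K6 census (790/790 X9 pairs, `N < 5·10⁵`),
the cell's Heegner-twin table (790/790, HOME/p2/X9-TWINS-v1) and family sweep (1330/1330 members of the
three genus-0 families to `N = 10¹⁰`, HOME/p2/MUSWEEP-19630-FAMILIES) — `μ > 0` found nowhere.

References: [EmertonPollackWeston2006] Thm. 1 (arXiv:math/0404484 p. 2), §1 Notation (p. 5), §2.6;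
[GreenbergVatsal2000] §3 Rem. (3.4), Prop. (3.7); [Mazur1978] Cor. 4.1; [GreenbergLNM1716] §1 Conj. 1.11;
[Carayol1986]; [BCDTJAMS2001] Thm. A.
-/

-- the summit and its single problem are both named `BirchSwinnertonDyer` (registry layout D-0017)
set_option linter.dupNamespace false

set_option autoImplicit false

noncomputable section

open scoped Classical MatrixGroups ModularForm

open CongruenceSubgroup WeierstrassCurve Field
open Literature.NumberTheory.EllipticCurves Literature.NumberTheory.EllipticCurves.ModularForms
open Literature.NumberTheory.EllipticCurves.Rank1Residual (hasIrreducibleModPGaloisRep_of_torsionIso_symm)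
open Summit.BirchSwinnertonDyer.BirchSwinnertonDyer.Theses

namespace Summit.BirchSwinnertonDyer.BirchSwinnertonDyer.Rank1Residual

/-! ### §1 Crux ⟸ certified partners -/

/-- **Crux `AnalyticMuZeroX9` (route PrintX9) BY NAME from certified partners.** Granting EPW Thm. 1 at
odd `p` (`hEPW`), Mazur's odd Manin constant (`hM`, giving the period unit at every good `p ≥ 5` and at
`3`) and Carayol (`hlev`): IF every X9 pair `(W, p)` has a globally minimal partner `W'`, good ordinary
at `p`, with a `Γ_ℚ`-equivariant `W'[p] ≃ W[p]` and a newform `f'` of `W'` of some level carrying ONE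
`p`-adic unit coefficient of `L_p(f', α_{W'})`, THEN `Theses.PrintX9.AnalyticMuZeroX9`. Proof: `W'[p]` is
irreducible (transported) and `X10.certificate_of_torsionIso_of_ne_two'` (odd `p`) moves the certificate
to every newform of `W`. [cite: EmertonPollackWeston2006, Thm. 1 (arXiv:math/0404484 p. 2)]
[cite: Mazur1978, Cor. 4.1] [cite: GreenbergVatsal2000, §3 Remark (3.4)] -/
theorem printX9_analyticMuZeroX9_of_forall_exists_certifiedPartner
    (hEPW : EmertonPollackWeston2006.thm1_muAn_transfer_of_torsionIso_odd)
    (hM : mazur_not_dvd_maninConstant_of_odd)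
    (hlev : ∀ (N : ℕ) [NeZero N], IsNewformOf.level_eq_conductorNorm (N := N))
    (hpartner : ∀ (W : WeierstrassCurve ℚ) [W.IsElliptic] [W.IsGloballyMinimal] (p : ℕ) [Fact p.Prime],
      ClassX9 W p →
      ∃ (W' : WeierstrassCurve ℚ) (_ : W'.IsElliptic) (_ : W'.IsGloballyMinimal),
        W'.HasGoodReductionAtPrime p ∧ ¬ (p : ℤ) ∣ W'.frobeniusTrace p ∧
        (∃ e : geomTorsion W' (p : ℤ) ≃+ geomTorsion W (p : ℤ),
          ∀ (σ : Field.absoluteGaloisGroup ℚ) (P : geomTorsion W' (p : ℤ)), e (σ • P) = σ • e P) ∧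
        ∃ (N' : ℕ) (_ : NeZero N') (f' : CuspForm (Gamma0 N') 2), IsNewformOf W' f' ∧
          ∃ n : ℕ, ‖PowerSeries.coeff n (padicLFunction f' (unitRoot W' p : ℚ_[p]))‖ = 1) :
    PrintX9.AnalyticMuZeroX9 := by
  unfold PrintX9.AnalyticMuZeroX9 AnalyticMuZeroOnClassX9
  intro W _ _ p _ N _ f hX9 hf
  obtain ⟨W', _, _, hgood', hord', ⟨e, he⟩, N', _, f', hf', hcert'⟩ := hpartner W p hX9
  obtain ⟨-, hp5, hgood, hord, hirr, -⟩ := hX9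
  have hp2 : p ≠ 2 := by omega
  have hirr' : W'.HasIrreducibleModPGaloisRep p := hasIrreducibleModPGaloisRep_of_torsionIso_symm e he hirr
  exact Summit.BirchSwinnertonDyer.Rank1Residual.X10.certificate_of_torsionIso_of_ne_two' hEPW
    (SkinnerUrban2014.realPeriodRat_eq_unit_mul_plusPeriod_of_mazur hM)
    (SkinnerUrban2014.realPeriodRat_eq_unit_mul_plusPeriod_three_of_mazur hM) hlev W' W p hp2
    hgood' hord' hirr' hgood hord ⟨e, he⟩ f' hf' f hf hcert'

/-! ### §2 Crux ⟹ certified partners (the pair itself), and the equivalence -/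

/-- **Conversely, the crux supplies a certified partner for every X9 pair — the pair itself** (at the
newform given by modularity, `hmodP` = route aside 19266). [cite: BCDTJAMS2001, Thm. A] -/
theorem printX9_forall_exists_certifiedPartner_of_analyticMuZeroX9
    (hmodP : nonempty_modularParametrizationData) (hA : PrintX9.AnalyticMuZeroX9) :
    ∀ (W : WeierstrassCurve ℚ) [W.IsElliptic] [W.IsGloballyMinimal] (p : ℕ) [Fact p.Prime],
      ClassX9 W p →
      ∃ (W' : WeierstrassCurve ℚ) (_ : W'.IsElliptic) (_ : W'.IsGloballyMinimal),
        W'.HasGoodReductionAtPrime p ∧ ¬ (p : ℤ) ∣ W'.frobeniusTrace p ∧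
        (∃ e : geomTorsion W' (p : ℤ) ≃+ geomTorsion W (p : ℤ),
          ∀ (σ : Field.absoluteGaloisGroup ℚ) (P : geomTorsion W' (p : ℤ)), e (σ • P) = σ • e P) ∧
        ∃ (N' : ℕ) (_ : NeZero N') (f' : CuspForm (Gamma0 N') 2), IsNewformOf W' f' ∧
          ∃ n : ℕ, ‖PowerSeries.coeff n (padicLFunction f' (unitRoot W' p : ℚ_[p]))‖ = 1 := by
  intro W _ _ p _ hX9
  obtain ⟨-, -, hgood, hord, -, -⟩ := id hX9
  haveI : NeZero (W.conductorNorm ℤ) := ⟨(W.conductorNorm_pos_holds).ne'⟩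
  obtain ⟨Dm⟩ := hmodP W
  refine ⟨W, ‹_›, ‹_›, hgood, hord, ⟨AddEquiv.refl _, fun σ P => rfl⟩, W.conductorNorm ℤ, ‹_›, Dm.f,
    Dm.isNewformOf, ?_⟩
  unfold PrintX9.AnalyticMuZeroX9 AnalyticMuZeroOnClassX9 at hA
  exact hA W p Dm.f hX9 Dm.isNewformOf

/-- **The congruence road, class-wide, is EXACTLY crux 19630 (route PrintX9 currency).** Modulo EPW Thm.
1 at odd `p` (`hEPW`), Mazur's odd Manin constant (`hM`), Carayol (`hlev`) and modularity (`hmodP`):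
`Theses.PrintX9.AnalyticMuZeroX9 ↔ «every X9 pair has a certified good-ordinary p-congruent partner»`.
[cite: EmertonPollackWeston2006, Thm. 1 (arXiv:math/0404484 p. 2)] [cite: GreenbergLNM1716, §1 Conj. 1.11]
[cite: Mazur1978, Cor. 4.1] -/
theorem printX9_analyticMuZeroX9_iff_forall_exists_certifiedPartner
    (hEPW : EmertonPollackWeston2006.thm1_muAn_transfer_of_torsionIso_odd)
    (hM : mazur_not_dvd_maninConstant_of_odd)
    (hlev : ∀ (N : ℕ) [NeZero N], IsNewformOf.level_eq_conductorNorm (N := N))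
    (hmodP : nonempty_modularParametrizationData) :
    PrintX9.AnalyticMuZeroX9 ↔
    ∀ (W : WeierstrassCurve ℚ) [W.IsElliptic] [W.IsGloballyMinimal] (p : ℕ) [Fact p.Prime],
      ClassX9 W p →
      ∃ (W' : WeierstrassCurve ℚ) (_ : W'.IsElliptic) (_ : W'.IsGloballyMinimal),
        W'.HasGoodReductionAtPrime p ∧ ¬ (p : ℤ) ∣ W'.frobeniusTrace p ∧
        (∃ e : geomTorsion W' (p : ℤ) ≃+ geomTorsion W (p : ℤ),
          ∀ (σ : Field.absoluteGaloisGroup ℚ) (P : geomTorsion W' (p : ℤ)), e (σ • P) = σ • e P) ∧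
        ∃ (N' : ℕ) (_ : NeZero N') (f' : CuspForm (Gamma0 N') 2), IsNewformOf W' f' ∧
          ∃ n : ℕ, ‖PowerSeries.coeff n (padicLFunction f' (unitRoot W' p : ℚ_[p]))‖ = 1 :=
  ⟨printX9_forall_exists_certifiedPartner_of_analyticMuZeroX9 hmodP,
    printX9_analyticMuZeroX9_of_forall_exists_certifiedPartner hEPW hM hlev⟩

/-- **The same with the modularity input held as the route's aside** `ModularParametrizationSupply`
(19266) and the Mazur head of aside 19383's family; EPW (odd `p`) and Carayol by name. A kernel display;
not a route edit. [cite: EmertonPollackWeston2006, Thm. 1 (arXiv:math/0404484 p. 2)]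
[cite: Mazur1978, Cor. 4.1] [cite: GreenbergLNM1716, §1 Conj. 1.11] -/
theorem printX9_analyticMuZeroX9_iff_forall_exists_certifiedPartner_of_items
    (hEPW : EmertonPollackWeston2006.thm1_muAn_transfer_of_torsionIso_odd)
    (hM : mazur_not_dvd_maninConstant_of_odd)
    (hlev : ∀ (N : ℕ) [NeZero N], IsNewformOf.level_eq_conductorNorm (N := N))
    (hmodP : PrintX9.ModularParametrizationSupply) :
    PrintX9.AnalyticMuZeroX9 ↔
    ∀ (W : WeierstrassCurve ℚ) [W.IsElliptic] [W.IsGloballyMinimal] (p : ℕ) [Fact p.Prime],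
      ClassX9 W p →
      ∃ (W' : WeierstrassCurve ℚ) (_ : W'.IsElliptic) (_ : W'.IsGloballyMinimal),
        W'.HasGoodReductionAtPrime p ∧ ¬ (p : ℤ) ∣ W'.frobeniusTrace p ∧
        (∃ e : geomTorsion W' (p : ℤ) ≃+ geomTorsion W (p : ℤ),
          ∀ (σ : Field.absoluteGaloisGroup ℚ) (P : geomTorsion W' (p : ℤ)), e (σ • P) = σ • e P) ∧
        ∃ (N' : ℕ) (_ : NeZero N') (f' : CuspForm (Gamma0 N') 2), IsNewformOf W' f' ∧
          ∃ n : ℕ, ‖PowerSeries.coeff n (padicLFunction f' (unitRoot W' p : ℚ_[p]))‖ = 1 :=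
  printX9_analyticMuZeroX9_iff_forall_exists_certifiedPartner hEPW hM hlev hmodP

/-! ### §3 Carayol discharged: the equivalence modulo EPW, Mazur and MODULARITY only (appended p2 g2,
after lit g6's cone note DOSSIER v7.3 §22.10) -/

/-- **Carayol's `N = N_E` is a theorem over the tree granting modularity** (Atkin–Lehner Thm 4 /
Diamond–Shurman 8.8.1: `IsNewformOf.level_eq_conductorNorm_of_exists_isNewformOf'`, fed by
`exists_isNewformOf_of_nonempty_modularParametrizationData`): the `hlev` binder of §§1–2 from `hmodP`.
[cite: AtkinLehner1970, Thm. 4] [cite: DiamondShurman2005, Thm. 8.8.1] [cite: BCDTJAMS2001, Thm. A] -/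
theorem level_eq_conductorNorm_of_modularParametrizationData
    (hmodP : nonempty_modularParametrizationData) (N : ℕ) [NeZero N] :
    IsNewformOf.level_eq_conductorNorm (N := N) :=
  IsNewformOf.level_eq_conductorNorm_of_exists_isNewformOf'
    (exists_isNewformOf_of_nonempty_modularParametrizationData hmodP)

/-- **The congruence road, class-wide, is EXACTLY crux 19630 — modulo THREE print heads only**:
Emerton–Pollack–Weston Thm. 1 at odd `p` (`hEPW`), Mazur 1978 Cor. 4.1 (`hM`, route aside 19383) and
modularity as parametrisation data (`hmodP`, route aside 19266; it also discharges Carayol).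
`Theses.PrintX9.AnalyticMuZeroX9 ↔ «every X9 pair has a certified good-ordinary p-congruent partner»`.
[cite: EmertonPollackWeston2006, Thm. 1 (arXiv:math/0404484 p. 2)] [cite: Mazur1978, Cor. 4.1]
[cite: BCDTJAMS2001, Thm. A] [cite: GreenbergLNM1716, §1 Conj. 1.11] -/
theorem printX9_analyticMuZeroX9_iff_forall_exists_certifiedPartner_of_modularity
    (hEPW : EmertonPollackWeston2006.thm1_muAn_transfer_of_torsionIso_odd)
    (hM : mazur_not_dvd_maninConstant_of_odd)
    (hmodP : nonempty_modularParametrizationData) :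
    PrintX9.AnalyticMuZeroX9 ↔
    ∀ (W : WeierstrassCurve ℚ) [W.IsElliptic] [W.IsGloballyMinimal] (p : ℕ) [Fact p.Prime],
      ClassX9 W p →
      ∃ (W' : WeierstrassCurve ℚ) (_ : W'.IsElliptic) (_ : W'.IsGloballyMinimal),
        W'.HasGoodReductionAtPrime p ∧ ¬ (p : ℤ) ∣ W'.frobeniusTrace p ∧
        (∃ e : geomTorsion W' (p : ℤ) ≃+ geomTorsion W (p : ℤ),
          ∀ (σ : Field.absoluteGaloisGroup ℚ) (P : geomTorsion W' (p : ℤ)), e (σ • P) = σ • e P) ∧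
        ∃ (N' : ℕ) (_ : NeZero N') (f' : CuspForm (Gamma0 N') 2), IsNewformOf W' f' ∧
          ∃ n : ℕ, ‖PowerSeries.coeff n (padicLFunction f' (unitRoot W' p : ℚ_[p]))‖ = 1 :=
  printX9_analyticMuZeroX9_iff_forall_exists_certifiedPartner hEPW hM
    (fun N _ => level_eq_conductorNorm_of_modularParametrizationData hmodP N) hmodP

/-- **The same with the two print heads held as route PrintX9's own asides** `MazurManinConstantOdd`
(19383) and `ModularParametrizationSupply` (19266): the μ-crux 19630 of the route ⟺ one `μ`-certificate
per mod-`p` representation of class X9, granted EPW Thm. 1 (odd `p`) and those two asides — nothing else.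
[cite: EmertonPollackWeston2006, Thm. 1 (arXiv:math/0404484 p. 2)] [cite: Mazur1978, Cor. 4.1]
[cite: BCDTJAMS2001, Thm. A] -/
theorem printX9_analyticMuZeroX9_iff_forall_exists_certifiedPartner_of_asides
    (hEPW : EmertonPollackWeston2006.thm1_muAn_transfer_of_torsionIso_odd)
    (hM : PrintX9.MazurManinConstantOdd) (hmodP : PrintX9.ModularParametrizationSupply) :
    PrintX9.AnalyticMuZeroX9 ↔
    ∀ (W : WeierstrassCurve ℚ) [W.IsElliptic] [W.IsGloballyMinimal] (p : ℕ) [Fact p.Prime],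
      ClassX9 W p →
      ∃ (W' : WeierstrassCurve ℚ) (_ : W'.IsElliptic) (_ : W'.IsGloballyMinimal),
        W'.HasGoodReductionAtPrime p ∧ ¬ (p : ℤ) ∣ W'.frobeniusTrace p ∧
        (∃ e : geomTorsion W' (p : ℤ) ≃+ geomTorsion W (p : ℤ),
          ∀ (σ : Field.absoluteGaloisGroup ℚ) (P : geomTorsion W' (p : ℤ)), e (σ • P) = σ • e P) ∧
        ∃ (N' : ℕ) (_ : NeZero N') (f' : CuspForm (Gamma0 N') 2), IsNewformOf W' f' ∧
          ∃ n : ℕ, ‖PowerSeries.coeff n (padicLFunction f' (unitRoot W' p : ℚ_[p]))‖ = 1 :=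
  printX9_analyticMuZeroX9_iff_forall_exists_certifiedPartner_of_modularity hEPW hM hmodP

end Summit.BirchSwinnertonDyer.BirchSwinnertonDyer.Rank1Residual

end
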